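import Mathlib
import Summits.ValiantsHypothesis.ValiantsHypothesis.Theorems.RigidityForcesSymmetryRankRigidMinimalReprLaplaceFiveSeparatedCaptureLeadingMonomials

/-!
# ValiantsHypothesis / RigidityForcesSymmetry — crux `LaplaceOptimalFive` (stmt-ValiantsHypothesis-24813), symmetric capture:
# the READ-OFF INJECTION and ★ LEMMA Z (`finrank 𝒵(U) ≤ 3 · finrank U` for `finrank U ≤ 4`)

Second file of the EQUAL-SPANS case of `CaptureIneqSym` (memo `pub/val-lit/lmr/NOTE-p4g17-24813-K32-symmetric-capture.md` §8, CLAIM E).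
With the notation of ✓ `…SeparatedCaptureLeadingMonomials` (`deg`, `LM`, `Zsp`, `RO`):

* ★ `readOff_eq_zero` — a tuple `Q ∈ 𝒵(U)` (`U` a space of symmetric matrices) all of whose read-off coordinates vanish is zero.
  Proof: let `m*` be the top leading monomial among the five components `Q_b` and `Q_{b₀}` a component attaining it.
  `m* = x_a x_c` (`a < c`): `b₀ ∉ {a,c}` is a type-1 read-off; `b₀ = c` — the relation `(c,a)` puts `x_c² ≻ m*` into `Q_a`;
  `b₀ = a` — the relation `(a,c)` puts `x_a²` into `Q_c`, the relations `(c,d)` make `Q_c` free of the letter `c`, so the leading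
  monomial `m′` of `Q_c` lies in `[x_a², x_a x_c)` and avoids `c`: `m′ = x_a²` makes `(a, x_a x_c)` a type-2 read-off, a pair
  `m′ = x_i x_j` (`a < j < c`) is a type-1 read-off at `(c, m′)`, a square `m′ = x_j²` (`a < j < c`) puts `x_j x_c ≻ m*` into `Q_j`
  by the relation `(j,c)`.  `m* = x_a²`: `b₀ = a` contradicts `Q_a(a,a) = 0`; `b₀ > a` puts `x_a x_{b₀} ≻ m*` into `Q_a`; `b₀ < a`
  makes the leading monomial of `Q_a` a pair `x_i x_a` with `x_a² ∈ LM U`, a type-2 read-off.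
* ★ `finrank_Zsp_le` — LEMMA Z: the read-off map `𝒵(U) → ℂ^{RO U}` is injective, so `finrank 𝒵(U) ≤ #RO U ≤ 3·#LM U ≤ 3·finrank U`
  for `finrank U ≤ 4`.  (Sharp for pair-monomial spans; FALSE at `finrank U = 5`: `⟨x_a², x_a x_b, x_a x_c, x_a x_d, x_a x_e⟩`
  has `finrank 𝒵 = 16`.)

Honest framing.  Linear algebra; by itself closes nothing; `CaptureIneqSym`, K1 on `K₃ ⊔ K₂`, `LaplaceOptimalFive`
(OPEN · CONTESTED 72/120), `VP ≠ VNP` are NOT proved.  No definitions, no named facts; Mathlib + tree only.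
-/

set_option linter.dupNamespace false
set_option autoImplicit false

namespace Summit.ValiantsHypothesis.ValiantsHypothesis.Theorems.RigidityForcesSymmetryRankRigidMinimalRepr

namespace LaplaceFiveSeparatedCapture

open Finset

noncomputable section

/-- ★ READ-OFF INJECTION: a tuple `Q ∈ 𝒵(U)` (with `U` symmetric) all of whose read-off coordinates vanish is zero.
Case analysis on the top leading monomial `m*` among the five components `Q_b`. [folklore] -/
theorem readOff_eq_zero (U : Submodule ℂ (Fin 5 → Fin 5 → ℂ)) (hU : ∀ u ∈ U, ∀ p q, u p q = u q p)
    {Q : Fin 5 → Fin 5 → Fin 5 → ℂ} (hQ : Q ∈ Zsp U)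
    (hRO : ∀ x ∈ RO U, Q x.1 x.2.1.1 x.2.1.2 = 0) : Q = 0 := by
  classical
  obtain ⟨hQU, hE⟩ := hQ
  have hsym : ∀ b p q, Q b p q = Q b q p := fun b => hU _ (hQU b)
  by_contra hQ0
  -- some component is nonzero
  have hex : ∃ b, Q b ≠ 0 := by
    by_contra h
    push Not at h
    exact hQ0 (funext fun b => h b)
  obtain ⟨b₁, hb₁⟩ := hex
  -- the component of largest degree
  obtain ⟨b₀, -, hb₀max⟩ :=
    Finset.exists_max_image (Finset.univ : Finset (Fin 5)) (fun b => deg (Q b)) Finset.univ_nonempty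
  have hmax : ∀ b, deg (Q b) ≤ deg (Q b₀) := fun b => hb₀max b (Finset.mem_univ b)
  have hb₀ : Q b₀ ≠ 0 := by
    intro h0
    have h1 := deg_pos_of_ne_zero (hsym b₁) hb₁
    have h2 := hmax b₁
    rw [h0, deg_zero] at h2
    omega
  obtain ⟨⟨⟨a, c⟩, hac⟩, hdeg, hlead⟩ := exists_lead (hsym b₀) hb₀
  simp only at hlead
  have hwt : wt ⟨(a, c), hac⟩ = 5 * (c : ℕ) + (a : ℕ) := rfl
  have ha5 := a.isLt
  have hc5 := c.isLt
  -- entries above the top leading monomial vanish, in every component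
  have hzero : ∀ (b i j : Fin 5) (hij : i ≤ j), 5 * (c : ℕ) + (a : ℕ) < 5 * (j : ℕ) + (i : ℕ) → Q b i j = 0 := by
    intro b i j hij hlt
    apply entry_eq_zero_of_deg_le' i j hij
    have := hmax b
    rw [hdeg, hwt] at this
    omega
  have hmLM : (⟨(a, c), hac⟩ : J) ∈ LM U := lead_mem_LM (hQU b₀) hdeg
  -- read-off vanishing, unpacked
  have hRO1 : ∀ (b : Fin 5) (m : J), (b, m) ∈ RO1 U → Q b m.1.1 m.1.2 = 0 :=
    fun b m h => hRO (b, m) (Finset.mem_union_left _ h)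
  have hRO2 : ∀ (b : Fin 5) (m : J), (b, m) ∈ RO2 U → Q b m.1.1 m.1.2 = 0 :=
    fun b m h => hRO (b, m) (Finset.mem_union_right _ h)
  rcases lt_or_eq_of_le hac with hlt | heq
  · -- Case A: the top leading monomial is a genuine pair `x_a x_c`, `a < c`
    have hac' : (a : ℕ) < c := hlt
    by_cases hba : b₀ = a
    · -- A3: `b₀ = a`
      subst hba
      have hEac := hE b₀ c
      have hQcaa : Q c b₀ b₀ ≠ 0 := by
        intro h; rw [h, zero_add] at hEac
        exact hlead (by linear_combination hEac / 2)
      -- `Q_c` is `c`-free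
      have hcc : ∀ d, Q d c c = 0 := fun d => hzero d c c le_rfl (by omega)
      have hcfree : ∀ d, Q c c d = 0 := by
        intro d
        have h := hE c d
        rw [hcc d, zero_add] at h
        linear_combination h / 2
      have hcfree' : ∀ d, Q c d c = 0 := fun d => by rw [hsym]; exact hcfree d
      have hQc : Q c ≠ 0 := by intro h; exact hQcaa (by rw [h]; rfl)
      obtain ⟨⟨⟨i, j⟩, hij⟩, hdeg', hlead'⟩ := exists_lead (hsym c) hQc
      simp only at hlead'
      have hwt' : wt ⟨(i, j), hij⟩ = 5 * (j : ℕ) + (i : ℕ) := rfl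
      have hij' : (i : ℕ) ≤ j := hij
      have hi5 := i.isLt
      have hj5 := j.isLt
      -- weight window of `m'`
      have hlow : 5 * (b₀ : ℕ) + (b₀ : ℕ) < deg (Q c) :=
        wt_lt_deg_of_ne (m := ⟨(b₀, b₀), le_rfl⟩) hQcaa
      have hhigh : deg (Q c) ≤ 5 * (c : ℕ) + (b₀ : ℕ) + 1 := by
        have := hmax c; rw [hdeg, hwt] at this; exact this
      rw [hdeg', hwt'] at hlow hhigh
      have hjc : j ≠ c := by intro h; subst h; exact hlead' (hcfree' i)
      have hic : i ≠ c := by intro h; subst h; exact hlead' (hcfree j)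
      have hm'LM : (⟨(i, j), hij⟩ : J) ∈ LM U := lead_mem_LM (hQU c) hdeg'
      by_cases hsq : (i : ℕ) = b₀ ∧ (j : ℕ) = b₀
      · -- A3a: `m' = x_a²`: then `(a, x_a x_c)` is a read-off of type 2
        obtain ⟨hi, hj⟩ := hsq
        have hm'eq : (⟨(i, j), hij⟩ : J) = mkJ b₀ b₀ le_rfl :=
          Subtype.ext (Prod.ext (Fin.ext hi) (Fin.ext hj))
        have hsqLM : mkJ b₀ b₀ le_rfl ∈ LM U := hm'eq ▸ hm'LM
        have := hRO2 b₀ ⟨(b₀, c), hac⟩ (mem_RO2.mpr ⟨hmLM, hlt, Or.inl rfl, hsqLM⟩)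
        exact hlead this
      · -- A3b: `m'` strictly above `x_a²`: its top letter `j` satisfies `a < j < c`
        have hgt : 5 * (b₀ : ℕ) + (b₀ : ℕ) < 5 * (j : ℕ) + (i : ℕ) := by
          rcases Nat.lt_or_ge (5 * (b₀ : ℕ) + (b₀ : ℕ)) (5 * (j : ℕ) + (i : ℕ)) with h | h
          · exact h
          · exfalso; apply hsq; constructor <;> omega
        have hja : (b₀ : ℕ) < j := by
          by_contra h; push Not at h; omega
        have hjc' : (j : ℕ) < c := by
          rcases Nat.lt_or_ge (j : ℕ) c with h | h
          · exact h
          · exfalso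
            have : (j : ℕ) ≠ c := fun h' => hjc (Fin.ext h')
            omega
        rcases lt_or_eq_of_le hij with hilt | hieq
        · -- `m'` a pair avoiding `c`: read-off of type 1 at `(c, m')`
          have := hRO1 c ⟨(i, j), hij⟩ (mem_RO1.mpr ⟨hm'LM, hilt, Ne.symm hic, Ne.symm hjc⟩)
          exact hlead' this
        · -- `m' = x_j²` with `a < j < c`: equation `(j, c)` puts `x_j x_c ≻ x_a x_c` into `Q_j`
          have hieq' : i = j := hieq
          subst hieq'
          have h := hE i c
          have hjjc : Q i i c = 0 := hzero i i c (le_of_lt (Fin.lt_def.mpr hjc')) (by omega)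
          rw [hjjc, mul_zero, add_zero] at h
          exact hlead' h
    · by_cases hbc : b₀ = c
      · -- A2: `b₀ = c`: equation `(c, a)` puts `x_c² ≻ x_a x_c` into `Q_a`
        subst hbc
        have h := hE b₀ a
        have hacc : Q a b₀ b₀ = 0 := hzero a b₀ b₀ le_rfl (by omega)
        rw [hacc, zero_add, hsym b₀ b₀ a] at h
        exact hlead (by linear_combination h / 2)
      · -- A1: `b₀ ∉ {a, c}`: read-off of type 1
        exact hlead (hRO1 b₀ ⟨(a, c), hac⟩ (mem_RO1.mpr ⟨hmLM, hlt, hba, hbc⟩))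
  · -- Case B: the top leading monomial is a square `x_a²`
    have heq' : a = c := heq
    subst heq'
    by_cases hba : b₀ = a
    · -- B1
      subst hba
      have h := hE b₀ b₀
      exact hlead (by linear_combination h / 3)
    · have h := hE a b₀
      have hQaab : Q a a b₀ ≠ 0 := by
        intro h0; rw [h0, mul_zero, add_zero] at h; exact hlead h
      rcases lt_or_gt_of_ne hba with hlt | hgt
      · -- B2, `b₀ < a`: the leading monomial of `Q_a` is a pair `x_i x_a`, a read-off of type 2
        have hba' : (b₀ : ℕ) < a := hlt
        have hQa : Q a ≠ 0 := by intro h0; exact hQaab (by rw [h0]; rfl)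
        obtain ⟨⟨⟨i, j⟩, hij⟩, hdeg', hlead'⟩ := exists_lead (hsym a) hQa
        simp only at hlead'
        have hwt' : wt ⟨(i, j), hij⟩ = 5 * (j : ℕ) + (i : ℕ) := rfl
        have hij' : (i : ℕ) ≤ j := hij
        have hi5 := i.isLt
        have hj5 := j.isLt
        have hlow : 5 * (a : ℕ) + (b₀ : ℕ) < deg (Q a) :=
          wt_lt_deg_of_ne (m := ⟨(b₀, a), le_of_lt hlt⟩) (by simpa [hsym a b₀ a] using hQaab)
        have hhigh : deg (Q a) ≤ 5 * (a : ℕ) + (a : ℕ) + 1 := by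
          have := hmax a; rw [hdeg, hwt] at this; exact this
        rw [hdeg', hwt'] at hlow hhigh
        have hQaaa : Q a a a = 0 := by have h' := hE a a; linear_combination h' / 3
        have hne : ¬ (5 * (j : ℕ) + (i : ℕ) = 5 * (a : ℕ) + (a : ℕ)) := by
          intro h'
          have hji : (⟨(i, j), hij⟩ : J) = ⟨(a, a), le_rfl⟩ := wt_injective (by rw [hwt']; exact h')
          have hi : i = a := congrArg (fun m : J => m.1.1) hji
          have hj : j = a := congrArg (fun m : J => m.1.2) hji
          rw [hi, hj] at hlead'
          exact hlead' hQaaa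
        have hja : (j : ℕ) = a := by omega
        have hj : j = a := Fin.ext hja
        subst hj
        have hia : (i : ℕ) < j := by omega
        have hm'LM : (⟨(i, j), hij⟩ : J) ∈ LM U := lead_mem_LM (hQU j) hdeg'
        have := hRO2 j ⟨(i, j), hij⟩ (mem_RO2.mpr ⟨hm'LM, Fin.lt_def.mpr hia, Or.inr rfl, hmLM⟩)
        exact hlead' this
      · -- B2, `a < b₀`: `x_a x_{b₀} ≻ x_a²`
        have hab' : (a : ℕ) < b₀ := hgt
        have hb5 := b₀.isLt
        exact hQaab (hzero a a b₀ (le_of_lt hgt) (by omega))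

/-- ★ **LEMMA Z.**  For a space `U` of symmetric matrices with `finrank U ≤ 4`: `finrank 𝒵(U) ≤ 3 · finrank U`. [folklore] -/
theorem finrank_Zsp_le (U : Submodule ℂ (Fin 5 → Fin 5 → ℂ)) (hU : ∀ u ∈ U, ∀ p q, u p q = u q p)
    (h4 : Module.finrank ℂ U ≤ 4) : Module.finrank ℂ (Zsp U) ≤ 3 * Module.finrank ℂ U := by
  classical
  let Φ : Zsp U →ₗ[ℂ] (RO U → ℂ) :=
    { toFun := fun Q x => (Q : Fin 5 → Fin 5 → Fin 5 → ℂ) x.1.1 x.1.2.1.1 x.1.2.1.2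
      map_add' := by intro Q Q'; funext x; rfl
      map_smul' := by intro r Q; funext x; rfl }
  have hΦ : Function.Injective Φ := by
    rw [injective_iff_map_eq_zero]
    intro Q hQ0
    apply Subtype.ext
    refine readOff_eq_zero U hU Q.2 fun x hx => ?_
    have := congrFun hQ0 ⟨x, hx⟩
    exact this
  have h1 := LinearMap.finrank_le_finrank_of_injective hΦ
  rw [Module.finrank_fintype_fun_eq_card, Fintype.card_coe] at h1
  have h2 := card_LM_le_finrank U hU
  have h3 := card_RO_le U (h2.trans h4)
  omega

end

end LaplaceFiveSeparatedCapture

end Summit.ValiantsHypothesis.ValiantsHypothesis.Theorems.RigidityForcesSymmetryRankRigidMinimalRepr
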